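import Mathlib
import Summits.NavierStokesRegularity.FluidComputer.AbcClassIIEigenpairRow3002C
import Summits.NavierStokesRegularity.FluidComputer.AbcClassIIEigenpairOfComplexBases
import Summits.NavierStokesRegularity.FluidComputer.CertificateAbcSpectrumThirdChain2
import Summits.NavierStokesRegularity.FluidComputer.AbcLyapunovInstability

/-!
# GROUP-B ROW OF RECORD `Row5002C` (R = 500, class II, implementation 3, K₀ = 28, K_V = 112) AS A KERNEL
# IMPLICATION in arbitrary COMPLEX (unitary) orbit bases (profile-cert-3 g8, 2026-08-27)
HONEST FRAMING (D-0035/D-0074): not a claim about Navier–Stokes blow-up. WHAT THIS IS NOT: not NS evidence;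
MODEL lane (NS linearised about the forced ABC flow `abcFlow 1 1 1` at viscosity `1/(2π·500)`, class II);
no certificate, number or census word moves: the row below is CONDITIONAL on the transcribed facts the
3-B-nested certifier prints (their truth = the CERTIFIER AUDIT + AUDIT-BASIS-ℂ of implementation 3's basis,
kit j268037 PASSED).
**`row5002C_certified_eigenvalue_of_complex_bases`**: for ANY family of COMPLEX orthonormal bases of the
complexified class-II orbit spaces (`amc` its complex first-order matrix, cert-3 g8 `AbcClassIIComplexBasesPrep`)
— the kind of basis implementation 3 (cert3.py / abcsym3.py) computes in (AUDIT-BASIS-ℂ j268037 PASSED) —, IF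
the row's facts hold for the section matrices of `amc` — a trial pair
(`λ̃ = Row5002C.lamRe`, coordinates `ṽ` on `cubeIdx 112`) with residual `≤ Row5002C.rnorm` and tail mass
`≤ NT`, an exact bordered left inverse on `cubeIdx 28` with the printed bounds `Row5002C.alpha0 / betaB /
betaC` and `GB`, and the shell number `MU2L` on `cubeIdx 29 ∖ cubeIdx 28` (every constant of
`CertificateAbcSpectrumThirdChain2` BY NAME; `GB`, `NT`, `MU2L` = the exact binary64 of the JSON fields
`gB_hi`, `vt_norm_hi`, `MU2_b0_lo` of HOME/profile/cert/impl3/j252100/impl3_R500_II_K028.json, inline) —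
THEN `L_R|II` (R = 500) has an eigenvalue `λ⋆` with `|λ⋆ − λ̃| ≤ Row5002C.rho`, REAL, `Re λ⋆ > 0`, with
`2πλ⋆` an eigenvalue of the tree's linearised operator (`Torus.IsLinNSEigenvalue`), ISOLATED within
`Row5002C.rIso` in `amc`-coordinates, and (+ FPS06 Thm 2.2) the forced ABC flow is Lyapunov-UNSTABLE at
viscosity `1/(2π·500)` (rung R-α). The numeric closings (μ > 0, κ < 1, 2ρ < r_iso, tail constant, M ≤ M0)
are DISCHARGED in the kernel from the g3 chain (`Row5002C.chain_real`, `kappa_lt_one`, `real`, `unstable`).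
Mathlib + the files named; no new definitions. bears_on LADDER-NS N5 / Z4-a(1), N1* R-α. `backSubst_anti` is
reused from cert-3 g7's `AbcClassIIEigenpairRow3002C`; the statement is g7's real-bases row with `((am i j :
ℝ) : ℂ)` ↦ `amc i j` and the complex-bases end-to-end theorem
`isLinNSEigenvalue_near_of_nested_certificate_of_complex_bases`.
-/

noncomputable section

open scoped BigOperators ComplexConjugate InnerProductSpace
open Finset

namespace Summit.NavierStokesRegularity.FluidComputer.AbcClassIIEigenpair

open Literature.Analysis.FunctionSpaces Literature.Analysis.FunctionSpaces.Torus
open Literature.Analysis.FluidPDE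
open Summit.NavierStokesRegularity.FluidComputer.AbcClassII
open Summit.NavierStokesRegularity.FluidComputer.CertificateAbcSpectrum

section Row

variable (wf : Idx → Fam)
variable (hws : ∀ i : Idx, ∀ k ∉ i.1.1, wf i k = 0)
variable (hwt : ∀ (i : Idx) (k : Fin 3 → ℤ), ∑ j : Fin 3, ((k j : ℤ) : ℂ) * wf i k j = 0)
variable (hwII : ∀ i : Idx, IsClassII (wf i))
variable (hwon : ∀ (O : Orbit) (a b : Fin (odim O)),
  ∑ k ∈ O.1, (inner ℂ (wf ⟨O, a⟩ k) (wf ⟨O, b⟩ k) : ℂ) = if a = b then 1 else 0)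
variable (amc : Idx → Idx → ℂ)
variable (hamc : ∀ i j : Idx, amc i j =
  ∑ k ∈ i.1.1, (inner ℂ (wf i k) (Torus.lerayCoeff k (crossForm 1 1 1 (wf j) k)) : ℂ))

include hws hwt hwII hwon hamc in
/-- **Row5002C (T3: R = 500, class II, implementation 3) ⇒ a certified, real, unstable, isolated eigenvalue of
`L_500|II` and rung R-α**, CONDITIONAL on the row's transcribed facts in the certifier's own COMPLEX orbit basis. -/
theorem row5002C_certified_eigenvalue_of_complex_bases
    (vt : Idx → ℂ) (hvt0 : ∀ i, i ∉ cubeIdx 112 → vt i = 0)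
    (hres : ∑ i ∈ cubeIdx 112 ∪ (cubeIdx 112).biUnion nbrIdx,
      ‖(if i ∈ cubeIdx 112 then ((((Row5002C.lamRe : ℚ) : ℝ) : ℂ) - ((-(onormSq i.1 / 500) : ℝ) : ℂ)) * vt i
          else 0) - ∑ j ∈ cubeIdx 112, amc i j * vt j‖ ^ 2 ≤ ((Row5002C.rnorm : ℚ) : ℝ) ^ 2)
    (hntb : ∑ i ∈ cubeIdx 112 \ cubeIdx 28, ‖vt i‖ ^ 2 ≤
      (((1292560462104437 : ℚ) / 144115188075855872 : ℚ) : ℝ) ^ 2)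
    (Binv : ((↥(cubeIdx 28) → ℂ) × ℂ) →ₗ[ℂ] ((↥(cubeIdx 28) → ℂ) × ℂ))
    (hBinv : ∀ (c : ↥(cubeIdx 28) → ℂ) (m : ℂ),
      Binv (fun i : ↥(cubeIdx 28) =>
          ((((Row5002C.lamRe : ℚ) : ℝ) : ℂ) - ((-(onormSq i.1.1 / 500) : ℝ) : ℂ)) * c i -
          ∑ j : ↥(cubeIdx 28), amc i j * c j + m * vt i,
        ∑ i : ↥(cubeIdx 28), conj (vt i) * c i) = (c, m))
    (hαM : ∀ (c : ↥(cubeIdx 28) → ℂ) (g : ℂ),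
      ∑ j : ↥(cubeIdx 28), ‖(Binv (c, g)).1 j‖ ^ 2 + ‖(Binv (c, g)).2‖ ^ 2 ≤
        ((Row5002C.alpha0 : ℚ) : ℝ) ^ 2 * (∑ i : ↥(cubeIdx 28), ‖c i‖ ^ 2 + ‖g‖ ^ 2))
    (hβBM : ∀ w : Idx → ℂ,
      ∑ j : ↥(cubeIdx 28), ‖(Binv (fun i : ↥(cubeIdx 28) => -∑ j ∈ nbrIdx i \ cubeIdx 28,
          amc i j * w j, 0)).1 j‖ ^ 2 +
        ‖(Binv (fun i : ↥(cubeIdx 28) => -∑ j ∈ nbrIdx i \ cubeIdx 28,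
          amc i j * w j, 0)).2‖ ^ 2 ≤
        ((Row5002C.betaB : ℚ) : ℝ) ^ 2 * ∑ j ∈ (cubeIdx 28).biUnion nbrIdx \ cubeIdx 28, ‖w j‖ ^ 2)
    (hβCM : ∀ (c : ↥(cubeIdx 28) → ℂ) (g : ℂ),
      ∑ i ∈ ((cubeIdx 28).biUnion nbrIdx ∪ cubeIdx 112) \ cubeIdx 28,
        ‖-∑ j : ↥(cubeIdx 28), amc i j * (Binv (c, g)).1 j +
          (Binv (c, g)).2 * vt i‖ ^ 2 ≤
        ((Row5002C.betaC : ℚ) : ℝ) ^ 2 * (∑ i : ↥(cubeIdx 28), ‖c i‖ ^ 2 + ‖g‖ ^ 2))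
    (hgBM : ∀ w : Idx → ℂ,
      ‖(Binv (fun i : ↥(cubeIdx 28) => ∑ j ∈ nbrIdx i \ cubeIdx 28,
          amc i j * w j, 0)).2‖ ^ 2 ≤
        (((2198037866660847 : ℚ) / 562949953421312 : ℚ) : ℝ) ^ 2 *
          ∑ j ∈ (cubeIdx 28).biUnion nbrIdx \ cubeIdx 28, ‖w j‖ ^ 2)
    (hshellM : ∀ w : Idx → ℂ, (∀ i ∈ cubeIdx 28, w i = 0) →
      (((628200374963231 : ℚ) / 1125899906842624 : ℚ) : ℝ) * ∑ i ∈ cubeIdx (28 + 1) \ cubeIdx 28, ‖w i‖ ^ 2 ≤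
        ∑ i ∈ cubeIdx (28 + 1) \ cubeIdx 28,
          ((((Row5002C.lamRe : ℚ) : ℝ) : ℂ).re - (-(onormSq i.1 / 500)) - Real.sqrt 2) * ‖w i‖ ^ 2 -
        RCLike.re (∑ i ∈ (cubeIdx 28).biUnion nbrIdx \ cubeIdx 28,
          conj (∑ j : ↥(cubeIdx 28), amc i j *
            (Binv (fun i : ↥(cubeIdx 28) => ∑ j ∈ nbrIdx i \ cubeIdx 28,
              amc i j * w j, 0)).1 j) * w i)) :
    ∃ lam : ℂ, ‖lam - (((Row5002C.lamRe : ℚ) : ℝ) : ℂ)‖ ≤ ((Row5002C.rho : ℚ) : ℝ) ∧ lam.im = 0 ∧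
      0 < lam.re ∧
      Torus.IsLinNSEigenvalue (1 / (2 * Real.pi * 500)) (Torus.abcFlow 1 1 1) (2 * Real.pi * lam) ∧
      (∀ z : ℂ, z ≠ lam → ‖z - lam‖ < ((Row5002C.rIso : ℚ) : ℝ) →
        ∀ w : Idx → ℂ, (Summable fun i : Idx => (1 + onormSq i.1 / 500) ^ 2 * ‖w i‖ ^ 2) →
          (∀ i : Idx, ((-(onormSq i.1 / 500) : ℝ) : ℂ) * w i +
            ∑ j ∈ nbrIdx i, amc i j * w j = z * w i) → w = 0) ∧
      (Torus.fps2006_nonlinear_instability_of_eigenvalue →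
        Torus.IsLyapunovUnstableSteadyState (1 / (2 * Real.pi * 500))
          (fun x => (4 * Real.pi ^ 2 * (1 / (2 * Real.pi * 500))) • Torus.abcFlow 1 1 1 x)
          (Torus.abcFlow 1 1 1)) := by
  -- the row's constants
  set lt : ℂ := (((Row5002C.lamRe : ℚ) : ℝ) : ℂ) with hlt
  set α : ℝ := ((Row5002C.alpha0 : ℚ) : ℝ) with hαdef
  set βB : ℝ := ((Row5002C.betaB : ℚ) : ℝ) with hβBdef
  set βC : ℝ := ((Row5002C.betaC : ℚ) : ℝ) with hβCdef
  set gB : ℝ := (((2198037866660847 : ℚ) / 562949953421312 : ℚ) : ℝ) with hgBdef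
  set nt : ℝ := (((1292560462104437 : ℚ) / 144115188075855872 : ℚ) : ℝ) with hntdef
  set MU2 : ℝ := (((628200374963231 : ℚ) / 1125899906842624 : ℚ) : ℝ) with hMU2def
  set r₀ : ℝ := ((Row5002C.rnorm : ℚ) : ℝ) with hr₀def
  set μ : ℝ := MU2 - gB * nt with hμdef
  set M : ℝ := √((1 + βC ^ 2) / μ ^ 2 + (α + βB * √(1 + βC ^ 2) / μ) ^ 2) with hMdef
  have hlt_re : lt.re = ((Row5002C.lamRe : ℚ) : ℝ) := by rw [hlt, Complex.ofReal_re]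
  have hlt_im : lt.im = 0 := by rw [hlt, Complex.ofReal_im]
  have hα0 : 0 ≤ α := by rw [hαdef]; exact_mod_cast (by norm_num [Row5002C.alpha0] : (0 : ℚ) ≤ Row5002C.alpha0)
  have hβB0 : 0 ≤ βB := by rw [hβBdef]; exact_mod_cast (by norm_num [Row5002C.betaB] : (0 : ℚ) ≤ Row5002C.betaB)
  have hβC0 : 0 ≤ βC := by rw [hβCdef]; exact_mod_cast (by norm_num [Row5002C.betaC] : (0 : ℚ) ≤ Row5002C.betaC)
  have hgB0 : 0 ≤ gB := by rw [hgBdef]; exact_mod_cast (by norm_num : (0 : ℚ) ≤ 2198037866660847 / 562949953421312)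
  have hnt0 : 0 ≤ nt := by rw [hntdef]; exact_mod_cast (by norm_num : (0 : ℚ) ≤ 1292560462104437 / 144115188075855872)
  have hr₀0 : 0 ≤ r₀ := by rw [hr₀def]; exact_mod_cast (by norm_num [Row5002C.rnorm] : (0 : ℚ) ≤ Row5002C.rnorm)
  -- the printed `μ_eff` is below the exact `MU2 − gB·nt`, and positive
  have hmuμ : ((Row5002C.mu : ℚ) : ℝ) ≤ μ := by
    rw [hμdef, hMU2def, hgBdef, hntdef]
    exact_mod_cast (by norm_num [Row5002C.mu] :
      Row5002C.mu ≤ (628200374963231 : ℚ) / 1125899906842624 -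
        2198037866660847 / 562949953421312 * (1292560462104437 / 144115188075855872))
  have hmu0 : 0 < ((Row5002C.mu : ℚ) : ℝ) := by exact_mod_cast Row5002C.mu_pos
  have hμ : 0 < μ := lt_of_lt_of_le hmu0 hmuμ
  -- `M ≤ B := backSubstConst α₀ μ_eff β_B β_C′ ≤ M0` and the chain
  have hMB : M ≤ backSubstConst Row5002C.alpha0 Row5002C.mu Row5002C.betaB Row5002C.betaC := by
    rw [hMdef, backSubstConst, hαdef, hβBdef, hβCdef]
    exact backSubst_anti hα0 hβB0 hmu0 hmuμ
  obtain ⟨-, hBρ, hBκ, hBiso⟩ := Row5002C.chain_real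
  have hB0 : 0 < backSubstConst Row5002C.alpha0 Row5002C.mu Row5002C.betaB Row5002C.betaC := by
    rw [backSubstConst]
    refine Real.sqrt_pos.mpr (add_pos_of_pos_of_nonneg ?_ (sq_nonneg _))
    have : 0 < ((Row5002C.mu : ℚ) : ℝ) := hmu0
    positivity
  have hM0 : 0 ≤ M := by rw [hMdef]; exact Real.sqrt_nonneg _
  have hκ1 : ((Row5002C.kappa : ℚ) : ℝ) < 1 := by exact_mod_cast Row5002C.kappa_lt_one
  have hκM : 2 * Real.sqrt 2 * M ^ 2 * r₀ ≤ ((Row5002C.kappa : ℚ) : ℝ) := by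
    refine le_trans ?_ hBκ
    have : M ^ 2 ≤ backSubstConst Row5002C.alpha0 Row5002C.mu Row5002C.betaB Row5002C.betaC ^ 2 :=
      pow_le_pow_left₀ hM0 hMB 2
    have h2 : 0 ≤ 2 * Real.sqrt 2 := by positivity
    exact mul_le_mul_of_nonneg_right (mul_le_mul_of_nonneg_left this h2) hr₀0
  have hκ : 2 * Real.sqrt 2 * M ^ 2 * r₀ < 1 := lt_of_le_of_lt hκM hκ1
  have hρ : 2 * M * r₀ ≤ ((Row5002C.rho : ℚ) : ℝ) := by
    refine le_trans ?_ hBρ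
    exact mul_le_mul_of_nonneg_right (mul_le_mul_of_nonneg_left hMB zero_le_two) hr₀0
  have hiso : ((Row5002C.rIso : ℚ) : ℝ) ≤ (1 - 2 * Real.sqrt 2 * M ^ 2 * r₀) / M := by
    by_cases hMz : M = 0
    · -- degenerate: then `2√2 M² r₀ = 0` and the right side is `1/0 = 0`... excluded: M > 0 since α ≥ 0? use M ≥ 1/... 
      exfalso
      rw [hMdef] at hMz
      have := Real.sqrt_eq_zero'.mp hMz
      have h1 : 0 < (1 + βC ^ 2) / μ ^ 2 := by positivity
      nlinarith [sq_nonneg (α + βB * √(1 + βC ^ 2) / μ)]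
    have hMpos : 0 < M := lt_of_le_of_ne hM0 (Ne.symm hMz)
    calc ((Row5002C.rIso : ℚ) : ℝ)
        ≤ (1 - ((Row5002C.kappa : ℚ) : ℝ)) /
            backSubstConst Row5002C.alpha0 Row5002C.mu Row5002C.betaB Row5002C.betaC := hBiso
      _ ≤ (1 - 2 * Real.sqrt 2 * M ^ 2 * r₀) /
            backSubstConst Row5002C.alpha0 Row5002C.mu Row5002C.betaB Row5002C.betaC :=
          div_le_div_of_nonneg_right (by linarith) hB0.le
      _ ≤ (1 - 2 * Real.sqrt 2 * M ^ 2 * r₀) / M :=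
          div_le_div_of_nonneg_left (by linarith) hMpos hMB
  have h2ρ : 2 * (2 * M * r₀) < (1 - 2 * Real.sqrt 2 * M ^ 2 * r₀) / M := by
    have hreal : 2 * ((Row5002C.rho : ℚ) : ℝ) < ((Row5002C.rIso : ℚ) : ℝ) := by
      exact_mod_cast Row5002C.real.2
    linarith
  -- the tail constant: `MU2 ≤ Re λ̃ + (K₀+2)²/R − √2`
  have hs : Real.sqrt 2 < 1.41422 := (Real.sqrt_lt' (by norm_num)).mpr (by norm_num)
  have htailK : MU2 ≤ lt.re + ((28 : ℝ) + 2) ^ 2 / 500 - Real.sqrt 2 := by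
    rw [hlt_re, hMU2def]
    have : (((628200374963231 : ℚ) / 1125899906842624 : ℚ) : ℝ) + 1.41422 ≤
        ((Row5002C.lamRe : ℚ) : ℝ) + ((28 : ℝ) + 2) ^ 2 / 500 := by
      have h := (by norm_num [Row5002C.lamRe] :
        (628200374963231 : ℚ) / 1125899906842624 + 141422 / 100000 ≤ Row5002C.lamRe + (28 + 2) ^ 2 / 500)
      have h' : (((628200374963231 : ℚ) / 1125899906842624 + 141422 / 100000 : ℚ) : ℝ) ≤
          ((Row5002C.lamRe + (28 + 2) ^ 2 / 500 : ℚ) : ℝ) := by exact_mod_cast h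
      push_cast at h'
      linarith
    linarith
  -- the general theorem
  obtain ⟨lam, hclose, heig, hisol, hreal, -⟩ :=
    isLinNSEigenvalue_near_of_nested_certificate_of_complex_bases wf hws hwt hwII hwon amc hamc (R := 500) (by norm_num) 28 112 lt
      vt hvt0 hr₀0 hnt0 hres hntb Binv hBinv hα0 hβB0 hβC0 hgB0 hαM hβBM hβCM hgBM hshellM htailK hμdef hμ
      hMdef hκ
  have hclose' : ‖lam - lt‖ ≤ ((Row5002C.rho : ℚ) : ℝ) := hclose.trans hρ
  have him : lam.im = 0 := hreal hlt_im h2ρ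
  have hre : 0 < lam.re := by
    have h1 : |(lam - lt).re| ≤ ‖lam - lt‖ := Complex.abs_re_le_norm _
    rw [Complex.sub_re, hlt_re] at h1
    have h2 : 0 < ((Row5002C.lamRe : ℚ) : ℝ) - ((Row5002C.rho : ℚ) : ℝ) := by
      exact_mod_cast Row5002C.unstable
    have h3 := (abs_le.mp (h1.trans hclose')).1
    linarith
  refine ⟨lam, hclose', him, hre, heig, fun z hz hzr => hisol z hz (lt_of_lt_of_le hzr hiso), fun hFPS => ?_⟩
  have hν : 0 < 1 / (2 * Real.pi * (500 : ℝ)) := by positivity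
  have hμre : 0 < (2 * Real.pi * lam : ℂ).re := by
    have e1 : (2 * Real.pi * lam : ℂ).re = 2 * Real.pi * lam.re := by
      simp [Complex.mul_re, him]
    rw [e1]; positivity
  exact AbcLyapunovInstability.isLyapunovUnstable_abcFlow_of_eigenvalue hFPS hν 1 1 1 hμre heig

end Row

end Summit.NavierStokesRegularity.FluidComputer.AbcClassIIEigenpair

end
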